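import Literature.MathematicalPhysics.QuantumLattice.SchwingerGrowth
import Literature.MathematicalPhysics.QuantumLattice.SchwingerGrowthTwoFactor
import HarnessLib

/-!
# Growth of Schwinger functions: E0'' implies E0' (discharge)

Trunk **T-AQFT** (topic `MathematicalPhysics/QuantumLattice`), families `constructive-qft`,
`crit-ising`; discharge of the named fact
`Literature.MathematicalPhysics.QuantumLattice.SchwingerFamily.HasProductGrowth.hasLinearGrowth`
(`SchwingerGrowth`): for a Schwinger family on a finite-dimensional one-point space `E`, the
product growth condition E0'' of Osterwalder–Schrader II, `|𝔖ₙ(φ₁ ⊗ ⋯ ⊗ φₙ)| ≤ σₙ ∏ᵢ |φᵢ|_s`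
with `σₙ ≤ α (n!)^β`, implies the linear growth condition E0', `|𝔖ₙ(F)| ≤ σₙ' |F|_{n t}` with
`σₙ' ≤ α' (n!)^{β'}` (OS II, Appendix by S. Summers, Theorem "E0'' implies E0'", pp. 303–305).

Proof: iterate the two-factor lemma `twoFactor_bound` (`SchwingerGrowthTwoFactor`) over the `n`
one-point blocks (`norm_le_of_isTensorOf_bound`): if `‖T(φ₁ ⊗ ⋯ ⊗ φₙ)‖ ≤ A ∏ |φᵢ|_s` on tensor
products then `‖T G‖ ≤ A Kⁿ |G|_{n t}` for all `G ∈ 𝓢(Eⁿ, ℂ)`, the orders adding up block by block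
exactly as in Summers' induction ((A1) ⇒ (A2), `t = 2r + 7` for `E = ℝ⁴`). With `σₙ' = σₙ⁺ Kⁿ`
and `Kⁿ ≤ e^K n!` the factorial growth `σₙ' ≤ |α| e^K (n!)^{β+1}` follows.

## Sources

* K. Osterwalder, R. Schrader, *Axioms for Euclidean Green's functions II*, Comm. Math. Phys.
  42 (1975) 281–305: §IV.1 ((4.1) E0', (4.2) E0''), Remark 1 p. 287, and Appendix (S. Summers),
  pp. 303–305, Theorem "Condition E0'' implies E0'". [OsterwalderSchraderCMP1975]

## Mathlib and Literature

Used from Mathlib: `Fin.prod_univ_castSucc`, `Fin.snoc`, `Real.pow_div_factorial_le_exp`,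
`Real.rpow_add_one`. From the tree: `twoFactor_bound`, `tensorSnoc`, `tensorSnocLeft`
(`SchwingerGrowthTwoFactor`, `SchwartzTensorLineDeriv`), `schwartzNorm`, `norm_le_schwartzNorm`
(`SchwingerOSAxioms`), `SchwartzMap.constOfSubsingleton`, `IsTensorOf` (`SchwartzTensor`).
-/

open scoped SchwartzMap

noncomputable section

namespace Literature.MathematicalPhysics.QuantumLattice

variable {E : Type*} [NormedAddCommGroup E] [NormedSpace ℝ E]

/-- `F ⊗ ψ` is the tensor product of the family `(φ₀, …, φ_{j-1}, ψ)` when `F` is the tensor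
product of `(φ₀, …, φ_{j-1})` (OS 1973 §2, `f₁ ⊗ ⋯ ⊗ fₙ = (f₁ ⊗ ⋯ ⊗ fₙ₋₁) ⊗ fₙ`). [folklore] -/
theorem IsTensorOf.tensorSnoc {j : ℕ} {F : 𝓢((Fin j → E), ℂ)} {φ : Fin j → 𝓢(E, ℂ)}
    (hF : IsTensorOf F φ) (ψ : 𝓢(E, ℂ)) :
    IsTensorOf (tensorSnoc F ψ) (Fin.snoc φ ψ : Fin (j + 1) → 𝓢(E, ℂ)) := by
  intro x
  rw [tensorSnoc_apply, hF, Fin.prod_univ_castSucc]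
  simp [Fin.init, Fin.snoc_castSucc, Fin.snoc_last]

section Iterate

variable [FiniteDimensional ℝ E]

/-- **From product bounds to linear bounds** (Osterwalder–Schrader II, Appendix by S. Summers,
(A1) ⇒ (A2), iterated over the blocks of variables): for every order `s` there are `t` and `K ≥ 0`
(depending only on `E, s`) such that for all `n`, all continuous linear functionals `T` on
`𝓢(Eⁿ, ℂ)` and all `A ≥ 0`, if `‖T(φ₁ ⊗ ⋯ ⊗ φₙ)‖ ≤ A ∏ᵢ |φᵢ|_s` for all one-point test functions
`φᵢ` (tensor products via `IsTensorOf`), then `‖T G‖ ≤ A Kⁿ |G|_{n t}` for all `G`. Induction on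
`n` with the two-factor lemma `twoFactor_bound`. [cite: OsterwalderSchraderCMP1975, Appendix (S. Summers), Theorem E0'' ⇒ E0', pp. 303–305] -/
theorem norm_le_of_isTensorOf_bound (s : ℕ) :
    ∃ (t : ℕ) (K : ℝ), 0 ≤ K ∧ ∀ (n : ℕ) (T : 𝓢((Fin n → E), ℂ) →L[ℂ] ℂ) (A : ℝ), 0 ≤ A →
      (∀ (φ : Fin n → 𝓢(E, ℂ)) (F : 𝓢((Fin n → E), ℂ)), IsTensorOf F φ →
        ‖T F‖ ≤ A * ∏ i, schwartzNorm s (φ i)) →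
      ∀ G : 𝓢((Fin n → E), ℂ), ‖T G‖ ≤ A * K ^ n * schwartzNorm (n * t) G := by
  obtain ⟨t, K, hK0, htwo⟩ := twoFactor_bound (E := E) s
  refine ⟨t, K, hK0, fun n => ?_⟩
  induction n with
  | zero =>
    intro T A hA hT G
    set one : 𝓢((Fin 0 → E), ℂ) := SchwartzMap.constOfSubsingleton 1 with hone
    have hG : G = (G default) • one := by
      ext x
      rw [Subsingleton.elim x default]
      simp [hone]
    have h1 : ‖T one‖ ≤ A := by
      have h := hT Fin.elim0 one (fun x => by simp [hone])
      simpa using h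
    have hTG : T G = G default * T one := by
      conv_lhs => rw [hG]
      rw [map_smul, smul_eq_mul]
    rw [hTG, norm_mul]
    calc ‖G default‖ * ‖T one‖ ≤ schwartzNorm 0 G * A :=
          mul_le_mul (norm_le_schwartzNorm 0 G default) h1 (norm_nonneg _) (schwartzNorm_nonneg _ _)
      _ = A * K ^ 0 * schwartzNorm (0 * t) G := by rw [pow_zero, mul_one, zero_mul, mul_comm]
  | succ j ih =>
    intro T A hA hT G
    -- the hypothesis of the two-factor lemma, from the induction hypothesis applied to
    -- `F ↦ T (F ⊗ ψ)` with the constant `A |ψ|_s`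
    have hU : ∀ (F : 𝓢((Fin j → E), ℂ)) (ψ : 𝓢(E, ℂ)),
        ‖T (tensorSnoc F ψ)‖ ≤ A * K ^ j * schwartzNorm (j * t) F * schwartzNorm s ψ := by
      intro F ψ
      have hhyp : ∀ (φ : Fin j → 𝓢(E, ℂ)) (F' : 𝓢((Fin j → E), ℂ)), IsTensorOf F' φ →
          ‖(T.comp (tensorSnocLeft ψ)) F'‖ ≤ A * schwartzNorm s ψ * ∏ i, schwartzNorm s (φ i) := by
        intro φ F' hF'
        calc ‖(T.comp (tensorSnocLeft ψ)) F'‖ = ‖T (tensorSnoc F' ψ)‖ := rfl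
          _ ≤ A * ∏ i, schwartzNorm s ((Fin.snoc φ ψ : Fin (j + 1) → 𝓢(E, ℂ)) i) :=
              hT _ _ (hF'.tensorSnoc ψ)
          _ = A * schwartzNorm s ψ * ∏ i, schwartzNorm s (φ i) := by
              rw [Fin.prod_univ_castSucc]
              simp only [Fin.snoc_castSucc, Fin.snoc_last]
              ring
      have h := ih (T.comp (tensorSnocLeft ψ)) (A * schwartzNorm s ψ)
        (mul_nonneg hA (schwartzNorm_nonneg _ _)) hhyp F
      calc ‖T (tensorSnoc F ψ)‖ = ‖(T.comp (tensorSnocLeft ψ)) F‖ := rfl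
        _ ≤ A * schwartzNorm s ψ * K ^ j * schwartzNorm (j * t) F := h
        _ = A * K ^ j * schwartzNorm (j * t) F * schwartzNorm s ψ := by ring
    have h := htwo j T (j * t) (A * K ^ j) (by positivity) hU G
    have ht' : (j + 1) * t = j * t + t := by ring
    calc ‖T G‖ ≤ A * K ^ j * K * schwartzNorm (j * t + t) G := h
      _ = A * K ^ (j + 1) * schwartzNorm ((j + 1) * t) G := by rw [ht']; ring

end Iterate

/-- **Discharge of `SchwingerFamily.HasProductGrowth.hasLinearGrowth`** (E0'' implies E0';
Osterwalder–Schrader II, Remark 1 p. 287 and Appendix by S. Summers, pp. 303–305): from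
`|𝔖ₙ(φ₁ ⊗ ⋯ ⊗ φₙ)| ≤ σₙ ∏ |φᵢ|_s`, `σₙ ≤ α (n!)^β`, the iterated two-factor lemma
(`norm_le_of_isTensorOf_bound`) gives `|𝔖ₙ(F)| ≤ σₙ⁺ Kⁿ |F|_{n t}`, and
`σₙ⁺ Kⁿ ≤ |α| e^K (n!)^{β + 1}` since `Kⁿ ≤ e^K n!`. [cite: OsterwalderSchraderCMP1975, Appendix (S. Summers), Theorem E0'' ⇒ E0', pp. 303–305] -/
theorem SchwingerFamily.HasProductGrowth.hasLinearGrowth_holds :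
    SchwingerFamily.HasProductGrowth.hasLinearGrowth (E := E) := by
  intro _ S hS
  obtain ⟨s, σ, α, β, hσ, hb⟩ := hS
  obtain ⟨t, K, hK0, hP⟩ := norm_le_of_isTensorOf_bound (E := E) s
  refine ⟨t, fun n => max (σ n) 0 * K ^ n, |α| * Real.exp K, β + 1, fun n => ?_, fun n F => ?_⟩
  · have hfpos : (0 : ℝ) < n.factorial := by exact_mod_cast Nat.factorial_pos n
    have h1 : max (σ n) 0 ≤ |α| * (n.factorial : ℝ) ^ β :=
      max_le ((hσ n).trans (mul_le_mul_of_nonneg_right (le_abs_self α) (Real.rpow_nonneg hfpos.le β)))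
        (mul_nonneg (abs_nonneg α) (Real.rpow_nonneg hfpos.le β))
    have h2 : K ^ n ≤ Real.exp K * n.factorial := by
      have h := Real.pow_div_factorial_le_exp K hK0 n
      rwa [div_le_iff₀ hfpos] at h
    calc max (σ n) 0 * K ^ n ≤ (|α| * (n.factorial : ℝ) ^ β) * (Real.exp K * n.factorial) :=
          mul_le_mul h1 h2 (pow_nonneg hK0 n)
            (mul_nonneg (abs_nonneg α) (Real.rpow_nonneg hfpos.le β))
      _ = |α| * Real.exp K * ((n.factorial : ℝ) ^ β * n.factorial) := by ring
      _ = |α| * Real.exp K * (n.factorial : ℝ) ^ (β + 1) := by rw [Real.rpow_add_one hfpos.ne']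
  · have hyp : ∀ (φ : Fin n → 𝓢(E, ℂ)) (G : 𝓢((Fin n → E), ℂ)), IsTensorOf G φ →
        ‖S n G‖ ≤ max (σ n) 0 * ∏ i, schwartzNorm s (φ i) := fun φ G hG =>
      (hb n φ G hG).trans (mul_le_mul_of_nonneg_right (le_max_left _ _)
        (Finset.prod_nonneg fun i _ => schwartzNorm_nonneg _ _))
    exact hP n (S n) _ (le_max_right _ _) hyp F

end Literature.MathematicalPhysics.QuantumLattice
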